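import Mathlib
import HarnessLib
import Summits.HubbardSuperconductivity.HubbardSuperconductivity.Theorems.KLProgrammeKLRegimeEngineTowerRemeasureNarrowWideSplit
import Summits.HubbardSuperconductivity.HubbardSuperconductivity.Theorems.KLProgrammeKLRegimeEngineNormsJumpLastLegCountUniform

/-!
# Route `KLProgramme` — crux K3 ENGINE (stmt-HubbardSuperconductivity-20437 `KLRegimeEngineV17F2`), stub (b) v2, THE LEVELS PACKAGE (ℓ), instantiation (I2):
# THE LEVELLED NARROW / WIDE SPLIT JUMP WITH m-UNIFORM CONSTANTS (located item «(I2)-CONST-UNIFORM», prep «U6» for the `F = 1` track of «(I2)-KIT-HMU-LEV»;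
# cell gate-hubbard-kl, seat p4 g17)

`klLevNormOf_jump_le_narrowWideSplit_klEng (m) (hm)` (k3c2-p3, …RemeasureNarrowWideSplit §3) reads the per-degree one-determined-leg count
`card_relCount_prescribed_lastLeg_klAniso_le_window m` for its on-class term, so its constant `D₂` and the thresholds of that row are functions of `m`.  On the
m-uniform count `card_relCount_prescribed_lastLeg_klAniso_le_window_uniform` (p4 g17) the same proof gives the kit-ready form: every constant and threshold
BEFORE `m`, the jump constant as `C₀^{m+1}` (`C₀ = 3CJ/2`) and the on-class count constant as `(D₂ + 1)·(m + 2)³`.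

* **`klLevNormOf_jump_le_narrowWideSplit_klEng_uniform`** — binder list of the original with `∀ m, 3 ≤ m →` moved after the `R`-level existentials.
Composition of landed theorems; nothing about the model is asserted beyond them; nothing asserts (ℓ), any stub, K3 or superconductivity.
References: BGM 2006 §2.8 (2.82)–(2.84), (2.88)–(2.90), App. A3 [cite: BenfattoGiulianiMastropietro2006].
-/

noncomputable section

namespace Summit.HubbardSuperconductivity.HubbardSuperconductivity.Theorems.EngineV8

set_option linter.dupNamespace false -- summit = problem name (single-conjunct summit), D-0017

open Classical
open Real Finset Literature.MathematicalPhysics.QuantumLattice Literature.Probability.LatticeModels GrassmannAlgebra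
open Literature.MathematicalPhysics.QuantumLattice.FermiRG
open Summit.HubbardSuperconductivity.HubbardSuperconductivity.Theorems.KLRegimeSplit
open Summit.HubbardSuperconductivity.HubbardSuperconductivity.Theorems.KLProgrammeLegKernels
open Summit.HubbardSuperconductivity.HubbardSuperconductivity.Theorems.DispersionFlow
open Summit.HubbardSuperconductivity.HubbardSuperconductivity.Theorems.KLRegimeWick
open Summit.HubbardSuperconductivity.HubbardSuperconductivity.Theorems.TorusFourierL2
open Summit.HubbardSuperconductivity.HubbardSuperconductivity.Theorems.PerturbedFermiCurve

/-- **THE LEVELLED JUMP, NARROW / WIDE SPLIT OF THE UMKLAPP-ACTIVE CLASS, ALL COUNTS DISCHARGED, m-UNIFORM CONSTANTS** (`m + 1 ≥ 4` legs; twin of `klLevNormOf_jump_le_narrowWideSplit_klEng`).  Class (leg-dependent):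
`B p = {σ′ : (∃ G₀ ≠ 0, σ′ on the umklapp class of G₀ at tolerance (m+1)Cw_k) ∧ (∃ b, ∀ i ≠ p, leg i within ⌊(Θ+5w_k)/w_k⌋ sectors of b modulo 2^k)}`;
OFF `B p` = off the class OR wide ⇒ `(m+1)−3` count (p4 `…offOrWide…`); ON `B p` ⇒ one-determined-leg count (`…lastLeg…`) against the pinned class sums, which are
`≤` (narrow multiplicity, p4 `card_onNarrow_pinned_le_window`) × (fully prescribed coarse norms `≤ N_f`).
[cite: BenfattoGiulianiMastropietro2006, §2.8 (2.82)-(2.84), (2.88)-(2.90), App. A3] -/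
theorem klLevNormOf_jump_le_narrowWideSplit_klEng_uniform :
    ∃ C₀ : ℝ, 0 < C₀ ∧ ∃ C : ℝ, 0 < C ∧ ∃ D₁ : ℝ, 0 < D₁ ∧ ∃ Cw : ℝ, 0 < Cw ∧
      ∃ c₂ cb K₁ K₂ c₀ c₂' : ℝ, 0 ≤ c₂ ∧ 0 < cb ∧ 2 + c₂ ≤ K₁ ∧ 0 < K₂ ∧ 0 < c₀ ∧ 0 < c₂' ∧
      ∃ D₂ : ℝ, 0 < D₂ ∧ ∃ k₀ : ℕ,
      ∀ R : RenConsts, R.WF2 → ∃ c₃ : ℝ, 0 < c₃ ∧ ∃ U₀ : ℝ, 0 < U₀ ∧ ∃ Λ : ℝ, 0 ≤ Λ ∧ ∃ r₀ : ℝ, 0 < r₀ ∧ ∃ v₀ : ℝ, 0 < v₀ ∧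
      ∀ m : ℕ, 3 ≤ m →
      ∀ (P : SplitConsts) (c : ℝ), P.WF → 0 < c → c ≤ klEngC₃6 P R → c ≤ c₃ →
      ∀ μ ∈ klWindowC, ∀ U : ℝ, 0 < U → U ≤ klEngU₀9 P R c → U ≤ U₀ → ∀ β : ℝ, klBetaMin ≤ β → β ≤ Real.exp (c / U ^ 2) →
      ∀ K : TrigPolyC4v, FrameOK R U (nScales β) μ K → ∀ (L M : ℕ) [NeZero L] [NeZero M],
      klEngL₃ β U ≤ L → klEngM₃ β U L ≤ M → ∀ k J' : ℕ, k₀ ≤ k → k + 1 ≤ J' → J' ≤ nScales β + 1 →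
      ∀ (Θ LΨ Bfib : ℝ), LΨ = (m + 1 : ℕ) + c₂ * (π / 2 + 5 * sectorWidth k) / (K₁ * Θ) → (2 : ℝ) ^ (-(J' : ℤ)) ≤ Θ →
        cb * (2 : ℝ) ^ (-(J' : ℤ)) ≤ Θ → K₂ * LΨ * (cb * (2 : ℝ) ^ (-(J' : ℤ))) ≤ c₂' * Θ →
        max ((2 * ((2 * c₀ * K₂ * cb / π + 1) * LΨ)) ^ 2) (4 * cb ^ 2 * K₂ ^ 2 / 1 ^ 2 * LΨ ^ 2) ≤ Bfib →
      ((m : ℝ) + 1) * (Cw + C) * sectorWidth k < 2 * π →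
      (((m : ℝ) + 1) * C + m * Λ * (⌊(Θ + 5 * sectorWidth k) / sectorWidth k⌋₊ : ℕ)) * sectorWidth k < v₀ →
      ((m : ℝ) + 1) * C * sectorWidth k < π →
      ∀ T : HubbardGrassmann L M,
        (∀ (m' : ℕ) (X : Fin m' → HubbardFieldIdx L M), ∑ i, signedMomentum L (X i).2 (X i).1.1.2 ≠ 0 → kernel ℂ T m' X = 0) →
      ∀ (Ωe : Fin (m + 1) → Option (SectorLeg (sectorCount J'))) (N Nf : ℝ), 0 ≤ N → 0 ≤ Nf →
        (∀ Ωe' : Fin (m + 1) → Option (SectorLeg (sectorCount k)), levelCount Ωe' = levelCount Ωe →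
          klLevNormOf L M β μ K k (m + 1) T Ωe' ≤ N) →
        (∀ Ωf : Fin (m + 1) → Option (SectorLeg (sectorCount k)), levelCount Ωf = m + 1 →
          klLevNormOf L M β μ K k (m + 1) T Ωf ≤ Nf) →
        klLevNormOf L M β μ K J' (m + 1) T Ωe ≤
          C₀ ^ (m + 1) * ((27 : ℝ) ^ (levelCount Ωe + 1) * (D₁ ^ (m + 1) + (5 : ℝ) ^ (m + 1) * ((m + 1 : ℕ) ^ 2 * (Bfib * 3 ^ (m - 2)))) *
              ((2 : ℝ) ^ (J' - k)) ^ (m - 2) * N +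
            (D₂ + 1) * ((m : ℝ) + 2) ^ 3 * 27 ^ (m + 1) * ((2 : ℝ) ^ (J' - k)) ^ (m - levelCount Ωe) *
              ((2 * ((m : ℝ) + 1) + 1) ^ 2 * (2 * (8 * π * (((m : ℝ) + 1) * C + m * Λ * (⌊(Θ + 5 * sectorWidth k) / sectorWidth k⌋₊ : ℕ)) / r₀ + 2) *
                (8 * (2 * ((⌊(Θ + 5 * sectorWidth k) / sectorWidth k⌋₊ : ℕ) : ℝ) + 1)) ^ m)) * Nf) := by
  obtain ⟨CJ, hCJ, hov⟩ := overlap_jump_sums_klEng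
  obtain ⟨C, hC, D₁, hD₁, Cw, hCw, c₂, cb, K₁, K₂, c₀, c₂', h1, h2, h3, h4, h5, h6, k₀, hoffR⟩ :=
    card_relCount_prescribed_offOrWide_klAniso_le_window
  obtain ⟨D₂, hD₂, honR⟩ := card_relCount_prescribed_lastLeg_klAniso_le_window_uniform
  refine ⟨3 * CJ / 2, by positivity, C, hC, D₁, hD₁, Cw, hCw, c₂, cb, K₁, K₂, c₀, c₂', h1, h2, h3, h4, h5, h6, D₂, hD₂, k₀,
    fun R hR2 => ?_⟩
  have hRj : ∀ j, 0 ≤ R.Gfr j := gfr_nonneg_of_wf2 hR2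
  obtain ⟨c₃, hc₃, U₀, hU₀, hoff'⟩ := hoffR R hRj
  obtain ⟨c₃', hc₃', U₀', hU₀', hon'⟩ := honR R hRj
  obtain ⟨c₃'', hc₃'', U₀'', hU₀'', Λ, hΛ, r₀, hr₀, v₀, hv₀, hmult⟩ := card_onNarrow_pinned_le_window R hRj
  refine ⟨min (min c₃ c₃') c₃'', lt_min (lt_min hc₃ hc₃') hc₃'', min (min U₀ U₀') U₀'', lt_min (lt_min hU₀ hU₀') hU₀'', Λ, hΛ, r₀, hr₀, v₀, hv₀, ?_⟩
  intro m hm P c hP hc hc6 hcm μ hμ U hU hU9 hUm β hβmin hβc K hK L M _ _ hL3 hM3 k J' hk₀ hJ hJN Θ LΨ Bfib hLΨ hΘt hΘδ hΘη hBfib hsmall hsmallv hπC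
    T hT Ωe N Nf hN0 hNf0 hN hNf
  have hD₂' : (0 : ℝ) ≤ (D₂ + 1) * ((m : ℝ) + 2) ^ 3 := by positivity
  have hβ : 0 < β := KLRegimeSplit.pos_of_klBetaMin_le hβmin
  have hkJ : k ≤ J' := by omega
  have hc1 : c ≤ c₃ := hcm.trans ((min_le_left _ _).trans (min_le_left _ _))
  have hc2 : c ≤ c₃' := hcm.trans ((min_le_left _ _).trans (min_le_right _ _))
  have hc3 : c ≤ c₃'' := hcm.trans (min_le_right _ _)
  have hU1 : U ≤ U₀ := hUm.trans ((min_le_left _ _).trans (min_le_left _ _))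
  have hU2 : U ≤ U₀' := hUm.trans ((min_le_left _ _).trans (min_le_right _ _))
  have hU3 : U ≤ U₀'' := hUm.trans (min_le_right _ _)
  obtain ⟨_, hcol₁, hrow₁⟩ := hov P R c hP hR2 hc hc6 μ hμ U hU hU9 β hβmin hβc K hK L M hL3 hM3 k J' hJ hJN
  have hc₁0 : (0 : ℝ) ≤ 3 * CJ * M / β := by positivity
  have hBfib0 : 0 ≤ Bfib := le_trans (le_trans (sq_nonneg _) (le_max_left _ _)) hBfib
  -- the transversality radius in sector units, and the leg-dependent class ON ∩ NARROW
  set C' : ℕ := ⌊(Θ + 5 * sectorWidth k) / sectorWidth k⌋₊ with hC'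
  set B : Fin (m + 1) → Finset (Fin (m + 1) → SectorLeg (sectorCount k)) := fun p =>
    univ.filter fun σ' : Fin (m + 1) → SectorLeg (sectorCount k) =>
      (∃ G₀ : Fin 2 → ℤ, G₀ ≠ 0 ∧ ∀ j : Fin 2,
          |∑ i, (if (σ' i).2 = 0 then klFermiPoint μ K (sectorCenter k (σ' i).1.1) j
            else -klFermiPoint μ K (sectorCenter k (σ' i).1.1) j) - 2 * π * (G₀ j : ℝ)| ≤ ((m : ℝ) + 1) * C * sectorWidth k) ∧
      (∃ b : Fin (sectorCount k), ∀ i, i ≠ p → ∃ Dz : ℤ, |Dz| ≤ (C' : ℕ) ∧ ((2 : ℤ) ^ k) ∣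
        ((((if (σ' i).2 = 0 then ((σ' i).1.1 : ℕ) else
            if ((σ' i).1.1 : ℕ) < 2 ^ k then ((σ' i).1.1 : ℕ) + 2 ^ k else ((σ' i).1.1 : ℕ) - 2 ^ k : ℕ) : ℤ)) - b - Dz)) with hB
  -- the multiplicity and the on-class pinned bound
  set Mult : ℝ := (2 * ((m : ℝ) + 1) + 1) ^ 2 * (2 * (8 * π * (((m : ℝ) + 1) * C + m * Λ * (C' : ℕ)) / r₀ + 2) * (8 * (2 * ((C' : ℕ) : ℝ) + 1)) ^ m)
    with hMult
  have hMult0 : 0 ≤ Mult := by positivity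
  have hNB : ∀ (p : Fin (m + 1)) (ℓ : SectorLeg (sectorCount k)) (y : SpaceTimeIdx L M),
      imagTimeWeight β M ^ m *
        ∑ σ' ∈ (B p).filter (fun σ' : Fin (m + 1) → SectorLeg (sectorCount k) => σ' p = ℓ),
          ∑ x' ∈ univ.filter (fun x' : Fin (m + 1) → SpaceTimeIdx L M => x' p = y),
            ‖sectorisedKernel L M β (klAnisoFamily L M β μ K klE0 k) T (m + 1) σ' x'‖ ≤ Mult * Nf := by
    intro p ℓ y
    refine (pinnedClassSum_le_card_mul_of_full hβ μ K k T hT (B p) p ℓ y hNf).trans (mul_le_mul_of_nonneg_right ?_ hNf0)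
    -- the class with the pinned label fixed sits inside p4's summed narrow class
    have hcnt := hmult c hc hc3 U hU hU3 β hβmin hβc μ hμ μ K hK k m p ℓ C hC.le C' hsmallv hπC
    refine le_trans (Nat.cast_le.2 (card_le_card fun σ' hσ' => ?_)) hcnt
    simp only [hB, mem_filter, mem_univ, true_and] at hσ' ⊢
    obtain ⟨⟨⟨G₀, _, hG₀⟩, hnar⟩, hpℓ⟩ := hσ'
    exact ⟨hpℓ, ⟨G₀, hG₀⟩, hnar⟩
  have hA₁ : (0 : ℝ) ≤ (27 : ℝ) ^ (levelCount Ωe + 1) * (D₁ ^ (m + 1) + (5 : ℝ) ^ (m + 1) * ((m + 1 : ℕ) ^ 2 * (Bfib * 3 ^ (m - 2)))) *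
      ((2 : ℝ) ^ (J' - k)) ^ (m - 2) := by positivity
  have hA₂ : (0 : ℝ) ≤ (D₂ + 1) * ((m : ℝ) + 2) ^ 3 * 27 ^ (m + 1) * ((2 : ℝ) ^ (J' - k)) ^ (m - levelCount Ωe) := by positivity
  have hMN : 0 ≤ Mult * Nf := mul_nonneg hMult0 hNf0
  have h := klLevNormOf_jump_le_split_of_consts_legClass hβ μ K hJ T hT hc₁0 hc₁0 hcol₁ hrow₁ m B Ωe hA₁ hA₂ hN0 hMN
    (fun E τ'' σ' p hp hσ' hFE hEF => ?_) (fun E τ'' σ' p hp _ hFE hEF => ?_) hN hNB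
  · have hMne : (M : ℝ) ≠ 0 := by exact_mod_cast NeZero.ne M
    have hεc : imagTimeWeight β M * (3 * CJ * M / β) = 3 * CJ / 2 := by
      unfold imagTimeWeight; field_simp
    have hconst : (3 * CJ * M / β) ^ m * (3 * CJ * M / β) * imagTimeWeight β M ^ (m + 1) = (3 * CJ / 2) ^ (m + 1) := by
      rw [← pow_succ, ← mul_pow, mul_comm (3 * CJ * M / β), hεc]
    calc klLevNormOf L M β μ K J' (m + 1) T Ωe
        ≤ (3 * CJ * M / β) ^ m * (3 * CJ * M / β) * imagTimeWeight β M ^ (m + 1) *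
            ((27 : ℝ) ^ (levelCount Ωe + 1) * (D₁ ^ (m + 1) + (5 : ℝ) ^ (m + 1) * ((m + 1 : ℕ) ^ 2 * (Bfib * 3 ^ (m - 2)))) *
                ((2 : ℝ) ^ (J' - k)) ^ (m - 2) * N +
              (D₂ + 1) * ((m : ℝ) + 2) ^ 3 * 27 ^ (m + 1) * ((2 : ℝ) ^ (J' - k)) ^ (m - levelCount Ωe) * (Mult * Nf)) := h
      _ = (3 * CJ / 2) ^ (m + 1) *
            ((27 : ℝ) ^ (levelCount Ωe + 1) * (D₁ ^ (m + 1) + (5 : ℝ) ^ (m + 1) * ((m + 1 : ℕ) ^ 2 * (Bfib * 3 ^ (m - 2)))) *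
                ((2 : ℝ) ^ (J' - k)) ^ (m - 2) * N +
              (D₂ + 1) * ((m : ℝ) + 2) ^ 3 * 27 ^ (m + 1) * ((2 : ℝ) ^ (J' - k)) ^ (m - levelCount Ωe) * Mult * Nf) := by rw [hconst]; ring
  · -- off the class `B p`: off the umklapp class, or on it for some `G₀ ≠ 0` and not narrow about `p` ⇒ wide
    have hnot : ¬ ((∃ G₀ : Fin 2 → ℤ, G₀ ≠ 0 ∧ ∀ j : Fin 2,
          |∑ i, (if (σ' i).2 = 0 then klFermiPoint μ K (sectorCenter k (σ' i).1.1) j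
            else -klFermiPoint μ K (sectorCenter k (σ' i).1.1) j) - 2 * π * (G₀ j : ℝ)| ≤ ((m : ℝ) + 1) * C * sectorWidth k) ∧
        (∃ b : Fin (sectorCount k), ∀ i, i ≠ p → ∃ Dz : ℤ, |Dz| ≤ (⌊(Θ + 5 * sectorWidth k) / sectorWidth k⌋₊ : ℕ) ∧ ((2 : ℤ) ^ k) ∣
          ((((if (σ' i).2 = 0 then ((σ' i).1.1 : ℕ) else
              if ((σ' i).1.1 : ℕ) < 2 ^ k then ((σ' i).1.1 : ℕ) + 2 ^ k else ((σ' i).1.1 : ℕ) - 2 ^ k : ℕ) : ℤ)) - b - Dz))) := by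
      intro hh
      exact hσ' (by simp only [hB, mem_filter, mem_univ, true_and]; exact hh)
    have hcnt := hoff' c hc hc1 U hU hU1 β hβmin hβc μ hμ μ K hK L M m k J' hk₀ hkJ hm hsmall _ subset_rfl E τ'' p hp σ'
      Θ LΨ Bfib hLΨ hΘt hΘδ hΘη hBfib hnot
    exact (mul_le_mul_of_nonneg_left hcnt (by positivity)).trans
      (offOrWide_count_arith hD₁.le hBfib0 (J' - k) m (levelCount Ωe) E.card hm hEF)
  · -- on the class: the one-determined-leg count
    have hcnt := hon' m c hc hc2 U hU hU2 β hβmin hβc μ hμ μ K hK L M k J' hkJ _ subset_rfl E τ'' σ'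
    exact (mul_le_mul_of_nonneg_left hcnt (by positivity)).trans
      (legSet_count_arith hD₂' (J' - k) m (levelCount Ωe) E.card hFE ((card_le_univ _).trans_eq (Fintype.card_fin _)))

end Summit.HubbardSuperconductivity.HubbardSuperconductivity.Theorems.EngineV8

end
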